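import Summits.HodgeConjecture.HodgeConjecture.Theorems.MarkmanPartnerTransportLowPicardZeta11Theta
import Summits.HodgeConjecture.HodgeConjecture.Theorems.MarkmanPartnerTransportPicardThreeK3SquaresZeta11TypeOfConj

/-!
# Route MarkmanPartnerTransport · cruxes #4/#5 (stmt-HodgeConjecture-19652 / -19653) —
# «ZETA11-OFCONJ» CONSUMERS: Hilbert squares and the partnered `X` side on the `θ₁₁ = zeta11Theta` locus,
# hypotheses = marking + rational conjugacy ONLY

Cell hodge-nonav, INDEX v49 §6 A12 / T-A12 item (4) (planner p1 g41); prover seat hodge-nonav-19652-p1 (gen 13).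
Leaf (imports the route file through `…LowPicardZeta11Theta`); `--supports stmt-HodgeConjecture-19652` helper.
NO new named fact, no definition, no sorry.

Gen 16's `…LowPicardZeta11Theta` packages g11's K3-side theorem with the clause bundle `Zeta11Gen[S, η, t]`, which
asks for an annihilating separable `P` with `P(0) ≠ 0` on `T(S)` and the generation clause
`TranscendentalEndomorphismsGeneratedBy S t`. Gen 13's `RMTypeOrbit.hodgeConjectureFor_square_of_zeta11Theta_of_conj`
derives both (and `ρ(S) = 2`) from the rational conjugacy alone, so every consumer can be re-based on the slimmer
bundle

* `Zeta11Conj[S, η, t]` — `t` rational, Hodge-type preserving, kills `N¹(S)`, image cup-orthogonal to `N¹(S)`,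
  and `σηt = (zeta11Theta)_ℂ ση` for a RATIONAL ISOMETRY `σ` of `Λ_ℚ` (`zeta11Conj_of_zeta11Gen`: the old bundle
  implies the new one);

with the results

* `hodgeConjectureFor_square_of_zeta11Conj` — HC⁴(S ⊗ S); `finrank_algebraicClasses_eq_two_of_zeta11Conj` —
  `ρ(S) = 2` (fact-free);
* `hodgeConjectureFor_hilbertSquare_of_zeta11Conj` — HC⁴ of every Hilbert square `S^{[2]}` of such an `S` (blow up
  the diagonal, descend along `B_Δ(S × S) → S^{[2]}`; + `Beauville1983_hilbertSquare_blowupDiagonal_surjection`);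
* `hodgeConjectureFor_of_partner_zeta11Conj` — HC⁴(X) for EVERY marked smooth projective `K3^{[2]}`-type
  `(X, φ, P, z)` with a ledger partner `(S, η, p, x, g)` of the θ₁₁ conjugacy type (`partnerTransport_explicit`);
  these `X` have `ρ(X) = 3` and are the partnered members of cell (3,5) of crux #5 of that type;
* `oneCycleK3_of_partner_zeta11Conj` — for a cell member (`RMgen[X, φ, z, d]`) the PARTNERED CONJUNCT
  `OneCycleK3[S, hS, d]` of the crux-5 ledger;
* `hodgeConjectureFor_hilbertSquare_zeta11Conj` — the MARKED Hilbert square `(H, φ_H, P_H, (x,0))` (partnered by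
  Beauville's incidence, `partner_incidence`).

CONDITIONAL on the displayed named facts ({`Buskin2019_hodgeIsometry_algebraic`,
`VanGeemenSchuett2025_OguisoZhang2011_zeta11_cycleOnOpenPeriodSet`, `Huybrechts_K3_marking_exists`,
`Buskin2019_hodgeConjectureFor_square_of_CM`} on the K3 side — the last one is itself
`CMThird.hodgeConjectureFor_square_of_CM_of_buskin hB hmark` — plus the transport facts named in each
signature); credits nothing; nothing here proves the cell, the crux, or HC.

References: B. van Geemen, M. Schütt, Forum Math. Sigma 13 (2025) e2, Thm. 1.1 (11), §4.8, §5.8; K. Oguiso,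
D.-Q. Zhang, PAMQ 7 (2011) Thm. 1.5; E. Markman, Compos. Math. 160 (2024) Thm. 1.1, 1.4; A. Beauville,
J. Differential Geom. 18 (1983) §6; N. Buskin, J. reine angew. Math. 755 (2019) Thm. 1.1.
-/

noncomputable section

set_option linter.dupNamespace false

open scoped Matrix
open Module CategoryTheory MonoidalCategory Polynomial
open Literature.AlgebraicTopology.SingularHomology Literature.Geometry.Kaehler
open Literature.AlgebraicGeometry Literature.AlgebraicGeometry.Motives Literature.AlgebraicGeometry.HodgeTheory
open Literature.AlgebraicGeometry.Hyperkaehler Literature.AlgebraicGeometry.Surfaces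
open Literature.AlgebraicGeometry.HilbertScheme
open Summit.HodgeConjecture.HodgeConjecture.Theorems.NikulinTwinTransport
open Summit.HodgeConjecture.HodgeConjecture.Theorems.MarkmanPartnerTransport.BBFPositivity

namespace Summit.HodgeConjecture.HodgeConjecture.Theorems.MarkmanPartnerTransport.PartnerLattice

/-- `MarkedK3Sq[X, φ, P, z]`: VERBATIM the `let MarkedK3Sq := …` binder of the route declarations of
MarkmanPartnerTransport (clauses (m1)–(m6)). Local notation only. -/
local notation3 (prettyPrint := false) "MarkedK3Sq[" X ", " φ ", " P ", " z "]" =>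
  (((IsIntegralClass P ∧ ∀ Q : complexBetti X (2 * 4), IsIntegralClass Q → ∃ n : ℤ, Q = n • P) ∧
    (∀ c : complexBetti X 2, IsIntegralClass c ↔ ∃ v : K3HilbertIndex → ℤ, φ c = fun i => (v i : ℂ)) ∧
    (∀ a : complexBetti X 2, cupPowTwo a 4 = ((3 : ℂ) * (k3HilbertForm 2 (φ a) (φ a)) ^ 2) • P) ∧
    (IsOfHodgeType 4 X 2 2 0 (LinearEquiv.symm φ z) ∧
      ∀ τ : complexBetti X 2, IsOfHodgeType 4 X 2 2 0 τ → ∃ t : ℂ, τ = t • LinearEquiv.symm φ z) ∧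
    (∀ c : complexBetti X 2, IsOfHodgeType 4 X 2 1 1 c ↔
      (k3HilbertForm 2 (φ c) z = 0 ∧ k3HilbertForm 2 (φ c) (star z) = 0)) ∧
    (k3HilbertForm 2 z z = 0 ∧ 0 < (k3HilbertForm 2 (star z) z).re)))

/-- `MarkedK3[S, η, p, x]`: VERBATIM the `let MarkedK3 := …` binder of the route declarations (`p ≠ 0`, the six
marking clauses, the projective period point). Local notation only. -/
local notation3 (prettyPrint := false) "MarkedK3[" S ", " η ", " p ", " x "]" =>
  (p ≠ 0 ∧ (IsIntegralClass p ∧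
    (∀ q : complexBetti S (2 * 2), IsIntegralClass q → ∃ n : ℤ, q = n • p) ∧
    (∀ c : complexBetti S (2 * 1), IsIntegralClass c ↔ ∃ v : K3Index → ℤ, η c = fun i => (v i : ℂ)) ∧
    (∀ a b : complexBetti S (2 * 1),
      cupProduct (rfl : 2 * 1 + 2 * 1 = 2 * 2) a b = k3Form (η a) (η b) • p) ∧
    IsOfHodgeType 2 S (2 * 1) 2 0 (LinearEquiv.symm η x) ∧
    (∀ τ : complexBetti S (2 * 1), IsOfHodgeType 2 S (2 * 1) 2 0 τ →
      ∃ t : ℂ, τ = t • LinearEquiv.symm η x)) ∧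
    (k3Form x x = 0 ∧ 0 < (k3Form (star x) x).re ∧
      ∃ u : K3Index → ℤ, k3Form (fun i => (u i : ℂ)) x = 0 ∧ 0 < ∑ i, ∑ j, u i * k3Gram i j * u j))

/-- `RMgen[X, φ, z, d]` (VERBATIM `…LowPicardRMCells`). Local notation only. -/
local notation3 (prettyPrint := false) "RMgen[" X ", " φ ", " z ", " d "]" =>
  (∃ θ : complexBetti X 2 →ₗ[ℂ] complexBetti X 2, (∀ y, IsRationalClass y → IsRationalClass (θ y)) ∧
    (∀ (i j : ℕ) y, IsOfHodgeType 4 X 2 i j y → IsOfHodgeType 4 X 2 i j (θ y)) ∧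
    (∀ y w : complexBetti X 2, k3HilbertForm 2 (φ (θ y)) (φ w) = k3HilbertForm 2 (φ y) (φ (θ w))) ∧
    ∃ ev : ℂ, θ (LinearEquiv.symm φ z) = ev • LinearEquiv.symm φ z ∧ ev.im = 0 ∧
      (minpoly ℚ ev).natDegree = d ∧
      (∃ n : ℕ, 3 ≤ n ∧ d * n + Module.finrank ℂ ↥(algebraicClasses X 1) = 23) ∧
      ∀ f : complexBetti X 2 →ₗ[ℂ] complexBetti X 2, (∀ y, IsRationalClass y → IsRationalClass (f y)) →
        (∀ (i j : ℕ) y, IsOfHodgeType 4 X 2 i j y → IsOfHodgeType 4 X 2 i j (f y)) →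
        ∃ c : Fin d → ℚ, ∀ y : complexBetti X 2,
          (∀ a : complexBetti X 2, a ∈ algebraicClasses X 1 → k3HilbertForm 2 (φ y) (φ a) = 0) →
            f y = ∑ i : Fin d, ((c i : ℂ) • (θ ^ (i : ℕ)) y))

/-- `Partner[X, φ, S, η, g]`: clauses (g1), (g2), (g5) of the route's `IsK3Partner` datum (as in
`…LowPicardZeta11Theta`). Local notation only. -/
local notation3 (prettyPrint := false) "Partner[" X ", " φ ", " S ", " η ", " g "]" =>
  ((∀ a, IsRationalClass a → IsRationalClass (g a)) ∧
    (∀ (i j : ℕ) a, IsOfHodgeType 2 S (2 * 1) i j a → IsOfHodgeType 4 X 2 i j (g a)) ∧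
    (∀ a b, (∀ d ∈ algebraicClasses S 1, cupProduct (rfl : 2 * 1 + 2 * 1 = 2 * 2) a d = 0) →
      (∀ d ∈ algebraicClasses S 1, cupProduct (rfl : 2 * 1 + 2 * 1 = 2 * 2) b d = 0) →
      k3HilbertForm 2 (φ (g a)) (φ (g b)) = k3Form (η a) (η b)))

/-- `OneCycleK3[S, hS, d]` (VERBATIM `…LowPicardZeta11Theta`). Local notation only. -/
local notation3 (prettyPrint := false) "OneCycleK3[" S ", " hS ", " d "]" =>
  (∃ t : complexBetti S (2 * 1) →ₗ[ℂ] complexBetti S (2 * 1),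
    IsCycleInducedTranscendentalEndomorphism S (IsK3Surface.isSmoothProjective hS) t ∧
    ∃ (σ₁ : complexBetti S (2 * 1)) (ev : ℂ), IsOfHodgeType 2 S (2 * 1) 2 0 σ₁ ∧ σ₁ ≠ 0 ∧
      t σ₁ = ev • σ₁ ∧ (minpoly ℚ ev).natDegree = d)

/-- `Zeta11Gen[S, η, t]` (VERBATIM `…LowPicardZeta11Theta`): the gen-11 θ₁₁-type clause bundle WITH annihilating
polynomial and generation clause. Local notation only. -/
local notation3 (prettyPrint := false) "Zeta11Gen[" S ", " η ", " t "]" =>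
  ((∃ P : ℚ[X], P.Separable ∧ P.eval 0 ≠ 0 ∧ IsAnnihilatedOnTranscendentalBy S t P) ∧
    (∀ y, IsRationalClass y → IsRationalClass (t y)) ∧
    (∀ (i j : ℕ) (y : complexBetti S (2 * 1)), IsOfHodgeType 2 S (2 * 1) i j y → IsOfHodgeType 2 S (2 * 1) i j (t y)) ∧
    (∀ d ∈ algebraicClasses S 1, t d = 0) ∧
    (∀ (y : complexBetti S (2 * 1)), ∀ d ∈ algebraicClasses S 1,
      cupProduct (rfl : 2 * 1 + 2 * 1 = 2 * 2) (t y) d = 0) ∧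
    TranscendentalEndomorphismsGeneratedBy S t ∧
    ∃ σ : Module.End ℂ (K3Index → ℂ), (∀ a b, k3Form (σ a) (σ b) = k3Form a b) ∧
      (∀ v : K3Index → ℤ, ∃ w : K3Index → ℚ, σ (fun i => (v i : ℂ)) = fun i => (w i : ℂ)) ∧
      ∀ c : complexBetti S (2 * 1), σ (η (t c)) = thetaC zeta11Theta (σ (η c)))

/-- `Zeta11Conj[S, η, t]`: the SLIM θ₁₁-type clause bundle — `t` rational, Hodge-type preserving, kills `N¹(S)`,
image cup-orthogonal to `N¹(S)`, and conjugate by a RATIONAL ISOMETRY `σ` of `Λ_ℚ` to `(zeta11Theta)_ℂ` (VERBATIM the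
binders of `RMTypeOrbit.hodgeConjectureFor_square_of_zeta11Theta_of_conj`; no annihilating polynomial, no
generation clause). Local notation only. -/
local notation3 (prettyPrint := false) "Zeta11Conj[" S ", " η ", " t "]" =>
  ((∀ y, IsRationalClass y → IsRationalClass (t y)) ∧
    (∀ (i j : ℕ) (y : complexBetti S (2 * 1)), IsOfHodgeType 2 S (2 * 1) i j y → IsOfHodgeType 2 S (2 * 1) i j (t y)) ∧
    (∀ d ∈ algebraicClasses S 1, t d = 0) ∧
    (∀ (y : complexBetti S (2 * 1)), ∀ d ∈ algebraicClasses S 1,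
      cupProduct (rfl : 2 * 1 + 2 * 1 = 2 * 2) (t y) d = 0) ∧
    ∃ σ : Module.End ℂ (K3Index → ℂ), (∀ a b, k3Form (σ a) (σ b) = k3Form a b) ∧
      (∀ v : K3Index → ℤ, ∃ w : K3Index → ℚ, σ (fun i => (v i : ℂ)) = fun i => (w i : ℂ)) ∧
      ∀ c : complexBetti S (2 * 1), σ (η (t c)) = thetaC zeta11Theta (σ (η c)))

variable {X S : SchemeOver ℂ} {φ : complexBetti X 2 ≃ₗ[ℂ] (K3HilbertIndex → ℂ)} {P : complexBetti X (2 * 4)}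
  {z : K3HilbertIndex → ℂ} {η : complexBetti S (2 * 1) ≃ₗ[ℂ] (K3Index → ℂ)} {p : complexBetti S (2 * 2)}
  {x : K3Index → ℂ}

/-- The gen-11 clause bundle implies the slim one (drop `P` and the generation clause). [folklore] -/
theorem zeta11Conj_of_zeta11Gen {t : complexBetti S (2 * 1) →ₗ[ℂ] complexBetti S (2 * 1)} (ht : Zeta11Gen[S, η, t]) :
    Zeta11Conj[S, η, t] := by
  obtain ⟨-, h1, h2, h3, h4, -, σ, hσ, hσrat, hconj⟩ := ht
  exact ⟨h1, h2, h3, h4, σ, hσ, hσrat, hconj⟩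

/-- **HC⁴(S ⊗ S) on the θ₁₁ conjugacy locus, packaged** (`RMTypeOrbit.hodgeConjectureFor_square_of_zeta11Theta_of_conj`
with the clauses bundled as `Zeta11Conj`). [cite: GeemenSchutt2023, Thm. 1.1 (11) and §5.8]
[cite: OguisoZhang2011K3Order11, Thm. 1.5 (3)] [cite: Buskin2019, Thm. 1.1 and Corollary] -/
theorem hodgeConjectureFor_square_of_zeta11Conj (hB : Buskin2019_hodgeIsometry_algebraic)
    (hVGS : VanGeemenSchuett2025_OguisoZhang2011_zeta11_cycleOnOpenPeriodSet) (hmark : Huybrechts_K3_marking_exists)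
    (hCM : Buskin2019_hodgeConjectureFor_square_of_CM) (hS : IsK3Surface S) (hMS : MarkedK3[S, η, p, x])
    {t : complexBetti S (2 * 1) →ₗ[ℂ] complexBetti S (2 * 1)} (ht : Zeta11Conj[S, η, t]) :
    HodgeConjectureFor 4 (S ⊗ S) := by
  obtain ⟨h1, h2, h3, h4, σ, hσ, hσrat, hconj⟩ := ht
  exact RMTypeOrbit.hodgeConjectureFor_square_of_zeta11Theta_of_conj hB hVGS hmark hCM hS η p x hMS t h1 h2 h3 h4 σ
    hσ hσrat hconj

/-- **`ρ(S) = 2` on the θ₁₁ conjugacy locus, packaged** (`RMTypeOrbit.finrank_algebraicClasses_eq_two_of_zeta11Theta`;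
fact-free). [cite: GeemenSchutt2023, Thm. 1.1 (11) and §5.8] -/
theorem finrank_algebraicClasses_eq_two_of_zeta11Conj (hS : IsK3Surface S) (hMS : MarkedK3[S, η, p, x])
    {t : complexBetti S (2 * 1) →ₗ[ℂ] complexBetti S (2 * 1)} (ht : Zeta11Conj[S, η, t]) :
    Module.finrank ℂ ↥(algebraicClasses S 1) = 2 := by
  obtain ⟨-, h2, h3, -, σ, hσ, hσrat, hconj⟩ := ht
  exact RMTypeOrbit.finrank_algebraicClasses_eq_two_of_zeta11Theta hS η p x hMS t h2 h3 σ hσ hσrat hconj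

/-- **HC⁴ of every Hilbert square `S^{[2]}` of a K3 surface on the θ₁₁ conjugacy locus**: `S^{[2]}` is the
surjective image of the smooth blow-up of `S × S` along the diagonal
(`Beauville1983_hilbertSquare_blowupDiagonal_surjection`), so `hodgeConjectureFor_of_tower_surjective_le_five`
(pull-back input `fulton1998_map_mem_algebraicClasses_holds`) transports HC⁴(S ⊗ S). These Hilbert squares have
`ρ(S^{[2]}) = 3`: members of cell (3,5) of crux #5. CONDITIONAL on the five displayed facts; HC is NOT proved here.
[cite: GeemenSchutt2023, Thm. 1.1 (11), §5.8] [cite: Beauville1983, §6 (e)–(f), p. 766]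
[cite: Arapura2001HodgeCyclesModuli, Lemma 13 and Lemma 16] [cite: Buskin2019, Thm. 1.1] -/
theorem hodgeConjectureFor_hilbertSquare_of_zeta11Conj (hB : Buskin2019_hodgeIsometry_algebraic)
    (hVGS : VanGeemenSchuett2025_OguisoZhang2011_zeta11_cycleOnOpenPeriodSet) (hmark : Huybrechts_K3_marking_exists)
    (hCM : Buskin2019_hodgeConjectureFor_square_of_CM) (hBea : Beauville1983_hilbertSquare_blowupDiagonal_surjection)
    {H : SchemeOver ℂ} (hS : IsK3Surface S) {Ξ : (S ⊗ H).left.IdealSheafData} (hHilb : IsHilbertSchemeOfPoints 2 S H Ξ)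
    (hH : IsSmoothProjective 4 H) (hMS : MarkedK3[S, η, p, x])
    {t : complexBetti S (2 * 1) →ₗ[ℂ] complexBetti S (2 * 1)} (ht : Zeta11Conj[S, η, t]) : HodgeConjectureFor 4 H := by
  obtain ⟨B, b, r, hBl, hrs⟩ := hBea S hS.isSmoothProjective H Ξ hHilb
  haveI := hrs
  exact hodgeConjectureFor_of_tower_surjective_le_five fulton1998_map_mem_algebraicClasses_holds (n := 4)
    (by norm_num) (Relation.ReflTransGen.single (hBl.smoothBlowupStep (by norm_num))) hBl.top hH r
    (hodgeConjectureFor_square_of_zeta11Conj hB hVGS hmark hCM hS hMS ht)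

/-- **HC⁴(X) for every `K3^{[2]}`-type fourfold with a ledger partner on the θ₁₁ conjugacy locus**:
`PartnerTransport` (`partnerTransport_explicit`) applied to `hodgeConjectureFor_square_of_zeta11Conj`. The partnered
members of cell (3,5) of crux #5 of the θ₁₁ type, with NO annihilating-polynomial or generation hypothesis on the
partner. Modulo {Buskin, vGS∕OZ open-family fact, marking fact, Buskin CM corollary, Beauville incidence,
Beauville blow-up, Markman lift, Voisin cup}. [cite: GeemenSchutt2023, Thm. 1.1 (11), §4.8, §5.8]
[cite: Markman2024, §1.1 Thm. 1.1 and Thm. 1.4] [cite: Beauville1983, §6 (e)–(f), Prop. 6] [cite: Buskin2019, Thm. 1.1] -/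
theorem hodgeConjectureFor_of_partner_zeta11Conj (hB : Buskin2019_hodgeIsometry_algebraic)
    (hVGS : VanGeemenSchuett2025_OguisoZhang2011_zeta11_cycleOnOpenPeriodSet) (hmark : Huybrechts_K3_marking_exists)
    (hCM : Buskin2019_hodgeConjectureFor_square_of_CM)
    (hBI : Beauville1983_hilbertSquare_markedIncidence) (hBea : Beauville1983_hilbertSquare_blowupDiagonal_surjection)
    (hMk : Markman2024_rationalHodgeIsometry_lift_algebraic_marked) (hcup : Voisin2003_cupProduct_algebraicClasses)
    (hX : IsSmoothProjective 4 X) (hK : IsOfK3HilbertSquareType X) (hM : MarkedK3Sq[X, φ, P, z]) (hS : IsK3Surface S)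
    (hMS : MarkedK3[S, η, p, x]) {g : complexBetti S (2 * 1) →ₗ[ℂ] complexBetti X 2} (hg : Partner[X, φ, S, η, g])
    {t : complexBetti S (2 * 1) →ₗ[ℂ] complexBetti S (2 * 1)} (ht : Zeta11Conj[S, η, t]) : HodgeConjectureFor 4 X := by
  have hsq := hodgeConjectureFor_square_of_zeta11Conj hB hVGS hmark hCM hS hMS ht
  obtain ⟨_, hmk, hxx, hxpos, hu⟩ := hMS
  obtain ⟨hg1, hg2, hg5⟩ := hg
  exact partnerTransport_explicit hBI hBea hMk hcup hX hK hM hS hmk hxx hxpos hu hg1 hg2 hg5 hsq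

/-- **The PARTNERED CONJUNCT of the crux-5 ledger on the θ₁₁ conjugacy locus**: a cell member `X`
(`RMgen[X, φ, z, d]`) with a ledger partner `S` carrying `t` with `Zeta11Conj[S, η, t]` has `OneCycleK3[S, hS, d]`
(HC⁴(S ⊗ S) ⟹ HC⁴(X) ⟹ one cycle-induced endomorphism of eigenvalue degree `d` on `S`,
`exists_oneCycleK3_of_partner_of_hodgeConjectureFor`). Modulo the displayed facts.
[cite: GeemenSchutt2023, Thm. 1.1 (11) and §4.8] [cite: Markman2024, §1.1 Thm. 1.1] [cite: CharlesMarkman2013, Thm. 1.1 (§1)] -/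
theorem oneCycleK3_of_partner_zeta11Conj (hB : Buskin2019_hodgeIsometry_algebraic)
    (hVGS : VanGeemenSchuett2025_OguisoZhang2011_zeta11_cycleOnOpenPeriodSet) (hmark : Huybrechts_K3_marking_exists)
    (hCM : Buskin2019_hodgeConjectureFor_square_of_CM)
    (hBI : Beauville1983_hilbertSquare_markedIncidence) (hBea : Beauville1983_hilbertSquare_blowupDiagonal_surjection)
    (hO : OGrady2008_dualBBFClass_algebraic) (hMk : Markman2024_rationalHodgeIsometry_lift_algebraic_marked)
    (hcup : Voisin2003_cupProduct_algebraicClasses) (hMkI : Markman2024_rationalHodgeIsometry_algebraic_marked)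
    (hV : VerbitskyGuan_cohomology_K3HilbertSquareType) (hChM : CharlesMarkman2013_lefschetzStandard_K3HilbertType)
    (hX : IsSmoothProjective 4 X) (hK : IsOfK3HilbertSquareType X) (hM : MarkedK3Sq[X, φ, P, z]) {d : ℕ}
    (hR : RMgen[X, φ, z, d]) (hS : IsK3Surface S) (hMS : MarkedK3[S, η, p, x])
    {g : complexBetti S (2 * 1) →ₗ[ℂ] complexBetti X 2} (hg : Partner[X, φ, S, η, g])
    {t : complexBetti S (2 * 1) →ₗ[ℂ] complexBetti S (2 * 1)} (ht : Zeta11Conj[S, η, t]) : OneCycleK3[S, hS, d] :=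
  exists_oneCycleK3_of_partner_of_hodgeConjectureFor hBI hO hcup hMkI hV hChM hX hK hM hR hS hMS hg
    (hodgeConjectureFor_of_partner_zeta11Conj hB hVGS hmark hCM hBI hBea hMk hcup hX hK hM hS hMS hg ht)

/-- **HC⁴ of the MARKED Hilbert square of a K3 surface on the θ₁₁ conjugacy locus** — Beauville's marked Hilbert
square `(H, φ_H, P_H, (x,0))` is partnered by the incidence (`partner_incidence`); it is a member of cell (3,5).
Modulo {Buskin, vGS∕OZ fact, marking fact, Buskin CM corollary, Beauville incidence, Beauville blow-up, Markman lift,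
Voisin cup}. [cite: GeemenSchutt2023, Thm. 1.1 (11)] [cite: Beauville1983, §6 Prop. 6]
[cite: Markman2024, §1.1 Thm. 1.1 and Thm. 1.4] -/
theorem hodgeConjectureFor_hilbertSquare_zeta11Conj (hB : Buskin2019_hodgeIsometry_algebraic)
    (hVGS : VanGeemenSchuett2025_OguisoZhang2011_zeta11_cycleOnOpenPeriodSet) (hmark : Huybrechts_K3_marking_exists)
    (hCM : Buskin2019_hodgeConjectureFor_square_of_CM)
    (hBI : Beauville1983_hilbertSquare_markedIncidence) (hBea : Beauville1983_hilbertSquare_blowupDiagonal_surjection)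
    (hMk : Markman2024_rationalHodgeIsometry_lift_algebraic_marked) (hcup : Voisin2003_cupProduct_algebraicClasses)
    {H : SchemeOver ℂ} {φH : complexBetti H 2 ≃ₗ[ℂ] (K3HilbertIndex → ℂ)} {PH : complexBetti H (2 * 4)}
    (hH : IsSmoothProjective 4 H) (hKH : IsOfK3HilbertSquareType H) (hMH : MarkedK3Sq[H, φH, PH, Sum.elim x 0])
    (hS : IsK3Surface S) (hMS : MarkedK3[S, η, p, x]) {θ : complexBetti (H ⊗ S) (2 * 2)}
    (hi : ∀ a : complexBetti S (2 * 1),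
      φH (corrAction complexOrientationFamily hH (IsK3Surface.isSmoothProjective hS)
        (rfl : 2 * 1 + 2 * 2 = 2 + 2 * 2) θ a) = Sum.elim (η a) 0)
    {t : complexBetti S (2 * 1) →ₗ[ℂ] complexBetti S (2 * 1)} (ht : Zeta11Conj[S, η, t]) : HodgeConjectureFor 4 H := by
  obtain ⟨hp0, ⟨-, -, hηint, hcupS, h20, h20span⟩, -, hxpos, -⟩ := id hMS
  exact hodgeConjectureFor_of_partner_zeta11Conj hB hVGS hmark hCM hBI hBea hMk hcup hH hKH hMH hS hMS
    (partner_incidence hS hp0 hηint hcupS h20 h20span hxpos hH hMH hi) ht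

end Summit.HodgeConjecture.HodgeConjecture.Theorems.MarkmanPartnerTransport.PartnerLattice

end
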